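import Mathlib
import Literature.MathematicalPhysics.QuantumFieldTheory.Balaban1983to89.T4AveragingDeficitBridge
import Literature.MathematicalPhysics.QuantumFieldTheory.Balaban1983to89.Beta.Ineq167OperatorUpper

/-!
# T4AveragingDeficitGaugeLift — the GAUGE-FIXED tangent lift of the NE3 energy route in the abelian model: Bałaban's constrained minimiser `H_k = GQ*(QGQ*)⁻¹` (B5 (1.103)) as the witness of `T4ConvexResponse.TangentLift` with the Landau-type fine tangency `Qψ ∈ T ∧ R∂*ψ = 0`, cost the COARSE CURVATURE ENERGY `‖∂₁φ‖` (constant `√(2 n^d γ₁)`), and the wall's consumer `dualResidual_le` (R2ᴱ) in DUAL ENERGY NORM form (cell `pub-balaban`, T4-DAG node U1 (b), spine estimate NE3, row T4-U1b.NE3-PROVE-P2d*, GEN 4; [folklore] glue over kernel theorems of the β sub-cell)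

HONEST FRAMING (cell `pub-balaban`, T4-DAG PAGE 1).  The cell's T4 target is the existence AND uniqueness of the
continuum limit of Bałaban's unit-scale averaged loop expectations on a FINITE torus T⁴ — strictly beyond ultraviolet
stability; NO mass gap statement, NOT the Clay problem, NOT summit progress.  This file is GLUE of the NE3
energy-convexity seat (P2).  `T4AveragingDeficitBridge` (v1.1) inhabited the wall leaf's second hypothesis shape
`T4ConvexResponse.TangentLift crit T fineT dP normF N Λ` with the face-layer lift `J` and the coarse `ℓ²` norm.  The
shape's docstring (l.465 of the leaf) asks for more: a lift «tangent to the fine constraints at u» INCLUDING THE GAUGE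
CONDITION (76) `R∂*A′ = 0`, at the «cost: the full gradient of φ».  The β sub-cell of this package has typed, for the
concrete position-space operators of B5, the constrained minimiser `H_k = GQ*(QGQ*)⁻¹` of (1.103)
(`Beta.FluctuationProjection.Hk`: `QvOp_Hk_mulVec : Q(H_kφ) = φ`, `R_div_Hk_mulVec : R∂ᴴ(H_kφ) = 0`), its curl energy
`½‖∂H_kφ‖² = n^d φᴴΔ_kφ` (`Beta.BlockEffectiveAction.curl_energy_Hk`, (1.65)) and the uniform upper bound
`φᴴΔ_kφ ≤ γ₁(d)·⟨∂₁φ, ∂₁φ⟩` (`Beta.Ineq167OperatorUpper.ineq167_upper`, the (1.67)-type bound with OUR constant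
`γ₁ = (π²/4)^{d+2}`; the paper prints none).  This module only ASSEMBLES them in the wall's vocabulary:
`tangentLift_gaugeFixed : TangentLift crit T (fun _ ψ ↦ Qψ ∈ T ∧ R∂ᴴψ = 0) (fun _ ↦ dQ) (fineNorm μ ν)
(φ ↦ ⟨∂₁φ, ∂₁φ⟩^{1/2}) (√(2 n^d γ₁))` — the lift costs the COARSE CURVATURE ENERGY of `φ`, nothing else (no `ℓ²`
mass: a coarse field with `∂₁φ = 0` is lifted to a curl-free fine field) — and the consumer `dualResidual_le` then gives the R2ᴱ
statement of the record IN THE DUAL ENERGY NORM: a fine field `u ∈ critSet K` that is critical for the fine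
quadratic action among the GAUGE-FIXED directions with block average in `T` has block average `Qu` whose coarse
residual on `T` satisfies `|D actC(Qu)[φ]| ≤ √(2 n^d γ₁) · 2√(6(d+2)) n² K · ⟨∂₁φ, ∂₁φ⟩^{1/2}` — i.e. the residual is
`O(K)` in `H^{−1}` (record §3 (3.6), R2ᴱ), constants depending on `d` and the fixed block size `n = L` only.  NE3 and
the cell's conditionals (BetaPertH, (B), (B^μ)) are not mentioned; nothing is asserted about Bałaban's non-linear
average (15), SU(N)-valued fields, his minimisers `U_k(V)` or the non-abelian `H_k(U)` of B11 §C.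

CITATION HEADER (lean-in-tree rule 2026-08-18).  No sentence of any paper is used as a hypothesis.  Context only:
T. Bałaban, *Propagators and renormalization transformations for lattice gauge theories. I*, Commun. Math. Phys. **95**
(1984) 17–40 [Balaban1984PropagatorsI] («B5»: (1.18) p. 20 the average; (1.91) p. 33 «a minimum of the form
½⟨A, Δ_aA⟩ − a⟨B, B⟩ under the conditions QA = B, R∂*A = 0»; (1.103) p. 34 `H_kB = GQ*(QGQ*)⁻¹B`; (1.65)–(1.67)
p. 29 the form Δ_k and its bounds — all typed and proved for the package's operators by the β sub-cell, rows BETA-an5 /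
(1.67) lane); T. Bałaban, Commun. Math. Phys. **102** (1985) 277–309 [Balaban1985Variational] («B11»: (75)–(76) p. 289,
(83) p. 290 — the constraint and gauge conditions whose linear abelian form is the fine tangency used here; (26)–(27)
p. 282 — the residual that `dualResidual_le` bounds).
[cite: Balaban1984PropagatorsI, (1.18) p. 20, (1.91) p. 33, (1.103) p. 34, (1.65)–(1.67) p. 29 (definitions /
context); Balaban1985Variational, (75)–(76) p. 289, (83) p. 290, (26)–(27) p. 282 (context only)]

WHAT IS PROVED (all [folklore], sorry-free).  §1 `sum_normSq_Fs_plane_le` (one ordered plane of `Σ‖F‖²` is at most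
the whole sum), `curlEnergy_re_eq` (`‖∂ψ‖²` as the real number `Σ_{x,μ,ν}‖F_{μν}(x)‖²`), `fineNorm_sq_le_curlEnergy`
(`fineNorm μ ν ψ² ≤ ‖∂ψ‖²` for `∂ = CurlOp (fine n M) n`, via `Fs = n·plaq`).  §2 `curlEnergy_Hk_eq` (`‖∂H_kφ‖² =
2 n^d Re φᴴΔ_kφ`, from `curl_energy_Hk`), `curlEnergy_Hk_le` (`≤ 2 n^d γ₁ ⟨∂₁φ,∂₁φ⟩`, from `ineq167_upper`),
`d1Sq_nonneg'`, `fineNorm_Hk_le` (`fineNorm μ ν (H_kφ) ≤ √(2n^dγ₁)·⟨∂₁φ,∂₁φ⟩^{1/2}`).  §3 `gaugeFix` (the Landau-type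
fine condition `R∂ᴴψ = 0`), `coarseEnergyNorm` (`⟨∂₁φ,∂₁φ⟩^{1/2} = (d1Sq φ)^{1/2}`), `gaugeFix_zero`, `gaugeFix_Hk`,
`tangentLift_gaugeFixed` (THE GAUGE-FIXED INSTANCE of the typed shape, every `crit`, `T`, plane; witness `H_kφ` at
`a = 1`, any `a > 0` giving the same operator by `Hk_indep`).  §4 `dualResidual_gaugeFixed` (R2ᴱ of the lineage,
abelian model, dual ENERGY norm, gauge-fixed criticality), `dualResidual_gaugeFixed_nonvacuous`.  The matching LOWER
comparison `⟨∂₁φ,∂₁φ⟩ ≤ Re φᴴΔ_kφ` (so the cost currency is the coarse curvature energy from both sides) is the tree's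
`B5Hk163Form166.ineq167_formDk_sharp` (not imported here).

NOT CLAIMED.  Anything about the NON-LINEAR average (15) or B11's non-abelian `H_k(U)`, `𝔊`; that Bałaban's
minimisers lie in `critSet`; `DefectDerivBound` for Bałaban's `𝓓` (the wall, GAPS G-ne3p2-1, non-abelian layer
[analysis]); the printed constants of (1.67)/(1.100) (`γ₁` is ours).  Record: HOME/t4/T4-EST-NE3-P2.md v1.20 §0 (p).
-/

set_option autoImplicit false

namespace Literature.MathematicalPhysics.QuantumFieldTheory.Balaban1983to89.T4AveragingDeficitGaugeLift

open scoped BigOperators Matrix ComplexConjugate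
open Finset Complex
open Literature.MathematicalPhysics.QuantumFieldTheory.Balaban1983to89.B5Prop11Plancherel
open Literature.MathematicalPhysics.QuantumFieldTheory.Balaban1983to89.B5Block118
open Literature.MathematicalPhysics.QuantumFieldTheory.Balaban1983to89.B5AverageCurlStokes
open Literature.MathematicalPhysics.QuantumFieldTheory.Balaban1983to89.B5Action121
open Literature.MathematicalPhysics.QuantumFieldTheory.Balaban1983to89.B5Value126
open Literature.MathematicalPhysics.QuantumFieldTheory.Balaban1983to89.B5Bounds167Lattice
open Literature.MathematicalPhysics.QuantumFieldTheory.Balaban1983to89.T4AveragingDeficit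
open Literature.MathematicalPhysics.QuantumFieldTheory.Balaban1983to89.T4AveragingDeficitBridge
open Literature.MathematicalPhysics.QuantumFieldTheory.Balaban1983to89.T4ConvexResponse
open Literature.MathematicalPhysics.QuantumFieldTheory.Balaban1983to89.Beta.FluctuationProjection
open Literature.MathematicalPhysics.QuantumFieldTheory.Balaban1983to89.Beta.BlockEffectiveAction
open Literature.MathematicalPhysics.QuantumFieldTheory.Balaban1983to89.Beta.Ineq167OperatorUpper

noncomputable section

variable {d : ℕ} (n : ℕ) [NeZero n] (M : Fin d → ℕ) [hM : ∀ μ, NeZero (M μ)]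

/-! ## §1 Dictionary: the plane-`(μ, ν)` energy norm of the bridge is dominated by the full curl energy -/

omit [NeZero n] hM in
/-- One ordered plane of `Σ_x Σ_{μ'} Σ_{ν'} ‖F_{μ'ν'}(x)‖²` is at most the whole sum. [folklore] -/
theorem sum_normSq_Fs_plane_le {N : Fin d → ℕ} [∀ μ, NeZero (N μ)] (c : ℂ) (A : Tor N × Fin d → ℂ) (μ ν : Fin d) :
    ∑ x : Tor N, ‖Fs N c A μ ν x‖ ^ 2 ≤ ∑ x : Tor N, ∑ μ' : Fin d, ∑ ν' : Fin d, ‖Fs N c A μ' ν' x‖ ^ 2 := by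
  refine Finset.sum_le_sum fun x _ => ?_
  calc ‖Fs N c A μ ν x‖ ^ 2 ≤ ∑ ν' : Fin d, ‖Fs N c A μ ν' x‖ ^ 2 :=
        Finset.single_le_sum (f := fun ν' => ‖Fs N c A μ ν' x‖ ^ 2) (fun _ _ => by positivity) (Finset.mem_univ ν)
    _ ≤ ∑ μ' : Fin d, ∑ ν' : Fin d, ‖Fs N c A μ' ν' x‖ ^ 2 :=
        Finset.single_le_sum (f := fun μ' => ∑ ν' : Fin d, ‖Fs N c A μ' ν' x‖ ^ 2) (fun _ _ => by positivity)
          (Finset.mem_univ μ)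

/-- The curl energy `‖∂ψ‖² = (∂ψ)ᴴ(∂ψ)` of a fine vector field, `∂ = CurlOp (fine n M) n` (ordered planes), as a real
number: `Σ_x Σ_μ Σ_ν ‖F_{μν}(x)‖²`. [folklore] -/
theorem curlEnergy_re_eq (ψ : Tor (fine n M) × Fin d → ℂ) :
    (star (CurlOp (fine n M) (n : ℂ) *ᵥ ψ) ⬝ᵥ (CurlOp (fine n M) (n : ℂ) *ᵥ ψ)).re
      = ∑ x : Tor (fine n M), ∑ μ : Fin d, ∑ ν : Fin d, ‖Fs (fine n M) (n : ℂ) ψ μ ν x‖ ^ 2 := by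
  rw [curl_energy_eq, form_CurlOp, Complex.ofReal_re]

/-- DICTIONARY: `fineNorm μ ν ψ² = n² Σ_x ‖plaq ψ μ ν (x)‖² = Σ_x ‖F_{μν}(x)‖² ≤ ‖∂ψ‖²`. [folklore] -/
theorem fineNorm_sq_le_curlEnergy (μ ν : Fin d) (ψ : Tor (fine n M) × Fin d → ℂ) :
    fineNorm n M μ ν ψ ^ 2
      ≤ (star (CurlOp (fine n M) (n : ℂ) *ᵥ ψ) ⬝ᵥ (CurlOp (fine n M) (n : ℂ) *ᵥ ψ)).re := by
  have hS : 0 ≤ ∑ x : Tor (fine n M), ‖plaq (fine n M) ψ μ ν x‖ ^ 2 := by positivity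
  have h1 : fineNorm n M μ ν ψ ^ 2 = ∑ x : Tor (fine n M), ‖Fs (fine n M) (n : ℂ) ψ μ ν x‖ ^ 2 := by
    unfold fineNorm
    rw [mul_pow, Real.sq_sqrt hS, Finset.mul_sum]
    refine Finset.sum_congr rfl fun x _ => ?_
    rw [Fs_eq_mul_plaq, norm_mul, Complex.norm_natCast, mul_pow]
  rw [h1, curlEnergy_re_eq]
  exact sum_normSq_Fs_plane_le (n : ℂ) ψ μ ν

/-! ## §2 The curl energy of Bałaban's constrained minimiser `H_k φ` is bounded by the coarse curvature energy -/

/-- `‖∂H_kφ‖² = 2 n^d · Re φᴴΔ_kφ` ((1.65) in kernel form, from `curl_energy_Hk`). [folklore] -/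
theorem curlEnergy_Hk_eq (a : ℝ) (ha : 0 < a) (φ : Tor M × Fin d → ℂ) :
    (star (CurlOp (fine n M) (n : ℂ) *ᵥ (Hk n NeZero.one_le M a ha *ᵥ φ))
        ⬝ᵥ (CurlOp (fine n M) (n : ℂ) *ᵥ (Hk n NeZero.one_le M a ha *ᵥ φ))).re
      = 2 * (n : ℝ) ^ d * (star φ ⬝ᵥ (DelK n NeZero.one_le M a ha *ᵥ φ)).re := by
  have h := curl_energy_Hk n NeZero.one_le M a ha φ
  have h2 : star (CurlOp (fine n M) (n : ℂ) *ᵥ (Hk n NeZero.one_le M a ha *ᵥ φ))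
        ⬝ᵥ (CurlOp (fine n M) (n : ℂ) *ᵥ (Hk n NeZero.one_le M a ha *ᵥ φ))
      = ((2 * (n : ℝ) ^ d : ℝ) : ℂ) * (star φ ⬝ᵥ (DelK n NeZero.one_le M a ha *ᵥ φ)) := by
    calc star (CurlOp (fine n M) (n : ℂ) *ᵥ (Hk n NeZero.one_le M a ha *ᵥ φ))
            ⬝ᵥ (CurlOp (fine n M) (n : ℂ) *ᵥ (Hk n NeZero.one_le M a ha *ᵥ φ))
          = 2 * (1 / 2 * (star (CurlOp (fine n M) (n : ℂ) *ᵥ (Hk n NeZero.one_le M a ha *ᵥ φ))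
            ⬝ᵥ (CurlOp (fine n M) (n : ℂ) *ᵥ (Hk n NeZero.one_le M a ha *ᵥ φ)))) := by ring
      _ = 2 * ((n : ℂ) ^ d * (star φ ⬝ᵥ (DelK n NeZero.one_le M a ha *ᵥ φ))) := by rw [h]
      _ = ((2 * (n : ℝ) ^ d : ℝ) : ℂ) * (star φ ⬝ᵥ (DelK n NeZero.one_le M a ha *ᵥ φ)) := by
          push_cast; ring
  rw [h2, Complex.re_ofReal_mul]

/-- `‖∂H_kφ‖² ≤ 2 n^d γ₁ ⟨∂₁φ, ∂₁φ⟩` (from `ineq167_upper`). [folklore] -/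
theorem curlEnergy_Hk_le (a : ℝ) (ha : 0 < a) (φ : Tor M × Fin d → ℂ) :
    (star (CurlOp (fine n M) (n : ℂ) *ᵥ (Hk n NeZero.one_le M a ha *ᵥ φ))
        ⬝ᵥ (CurlOp (fine n M) (n : ℂ) *ᵥ (Hk n NeZero.one_le M a ha *ᵥ φ))).re
      ≤ 2 * (n : ℝ) ^ d * gamma1 d * d1Sq M φ := by
  rw [curlEnergy_Hk_eq, mul_assoc (2 * (n : ℝ) ^ d)]
  exact mul_le_mul_of_nonneg_left (ineq167_upper n NeZero.one_le M a ha φ) (by positivity)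

/-- `0 ≤ ⟨∂₁φ, ∂₁φ⟩`. [folklore] -/
theorem d1Sq_nonneg' (φ : Tor M × Fin d → ℂ) : 0 ≤ d1Sq M φ := by
  unfold d1Sq; positivity

/-- THE LIFT CONSTANT OF THE CONSTRAINED MINIMISER: `fineNorm μ ν (H_kφ) ≤ √(2 n^d γ₁) · ⟨∂₁φ, ∂₁φ⟩^{1/2}`. [folklore] -/
theorem fineNorm_Hk_le (μ ν : Fin d) (a : ℝ) (ha : 0 < a) (φ : Tor M × Fin d → ℂ) :
    fineNorm n M μ ν (Hk n NeZero.one_le M a ha *ᵥ φ)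
      ≤ Real.sqrt (2 * (n : ℝ) ^ d * gamma1 d) * Real.sqrt (d1Sq M φ) := by
  have h0 : 0 ≤ fineNorm n M μ ν (Hk n NeZero.one_le M a ha *ᵥ φ) := by unfold fineNorm; positivity
  have h1 : fineNorm n M μ ν (Hk n NeZero.one_le M a ha *ᵥ φ) ^ 2 ≤ 2 * (n : ℝ) ^ d * gamma1 d * d1Sq M φ :=
    (fineNorm_sq_le_curlEnergy n M μ ν _).trans (curlEnergy_Hk_le n M a ha φ)
  have hγ : 0 ≤ 2 * (n : ℝ) ^ d * gamma1 d := by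
    have := gamma1_pos d; positivity
  rw [← Real.sqrt_mul hγ, Real.le_sqrt h0 (by have := d1Sq_nonneg' M φ; positivity)]
  exact h1

/-! ## §3 The gauge-fixed instance of `TangentLift` -/

/-- The Landau-type fine gauge condition `R∂ᴴψ = 0` of B5 (1.91) / B11 (76), for the package's typed operators
(`R = 1 − PcT`, `∂ᴴ = (GradOp (fine n M) n)ᴴ`). [cite: Balaban1984PropagatorsI, (1.91) p. 33 (definition)] -/
def gaugeFix (ψ : Tor (fine n M) × Fin d → ℂ) : Prop :=
  (1 - PcT n M (n : ℂ)) *ᵥ ((GradOp (fine n M) (n : ℂ))ᴴ *ᵥ ψ) = 0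

/-- The coarse curvature-energy seminorm `⟨∂₁φ, ∂₁φ⟩^{1/2} = (½ Σ_{μ,ν} Σ_y |(∂₁φ)_{μν}(y)|²)^{1/2}`. [folklore] -/
def coarseEnergyNorm (φ : Tor M × Fin d → ℂ) : ℝ := Real.sqrt (d1Sq M φ)

/-- The zero direction is gauge-fixed. [folklore] -/
theorem gaugeFix_zero : gaugeFix n M (0 : Tor (fine n M) × Fin d → ℂ) := by
  unfold gaugeFix
  rw [Matrix.mulVec_zero, Matrix.mulVec_zero]

/-- Bałaban's constrained minimiser is gauge-fixed: `R∂ᴴ(H_kφ) = 0`. [folklore] -/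
theorem gaugeFix_Hk (a : ℝ) (ha : 0 < a) (φ : Tor M × Fin d → ℂ) :
    gaugeFix n M (Hk n NeZero.one_le M a ha *ᵥ φ) :=
  R_div_Hk_mulVec n NeZero.one_le M a ha φ

/-- `TangentLift` INHABITED WITH THE GAUGE CONDITION: for every set of fine fields `crit`, every set of coarse
directions `T`, every plane, with the fine tangency «`Qψ ∈ T` AND `R∂ᴴψ = 0`» (the linear abelian form of B11's
constraint (75) imposed through further averaging and gauge condition (76)), `dP := dQ`, the fine energy-type norm
`fineNorm μ ν`, the COARSE CURVATURE-ENERGY seminorm `⟨∂₁φ,∂₁φ⟩^{1/2}` and `Λ = √(2 n^d γ₁(d))`: the witness is Bałaban's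
constrained minimiser `H_kφ = GQ*(QGQ*)⁻¹φ` (1.103) of the β sub-cell (`QvOp_Hk_mulVec`, `R_div_Hk_mulVec`; taken at
`a = 1`, the operator being independent of `a > 0` by `Hk_indep`), and the cost is its curl energy (1.65) bounded by the
(1.67)-type `ineq167_upper`.  Constants depend on `d` and the fixed block size `n = L` only. [folklore] -/
theorem tangentLift_gaugeFixed (crit : Set (Tor (fine n M) × Fin d → ℂ)) (T : Set (Tor M × Fin d → ℂ))
    (μ ν : Fin d) :
    TangentLift crit T (fun _ ψ => QvOp n M *ᵥ ψ ∈ T ∧ gaugeFix n M ψ) (fun _ => dQ n M) (fineNorm n M μ ν)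
      (coarseEnergyNorm M) (Real.sqrt (2 * (n : ℝ) ^ d * gamma1 d)) := by
  intro u _ φ hφ
  refine ⟨Hk n NeZero.one_le M 1 one_pos *ᵥ φ, ⟨?_, gaugeFix_Hk n M 1 one_pos φ⟩, ?_,
    fineNorm_Hk_le n M μ ν 1 one_pos φ⟩
  · rw [QvOp_Hk_mulVec]; exact hφ
  · rw [dQ_apply, QvOp_Hk_mulVec]

/-! ## §4 R2ᴱ in the dual energy norm, gauge-fixed criticality -/

/-- R2ᴱ OF THE LINEAGE, ABELIAN MODEL, DUAL ENERGY NORM (the wall's consumer `T4ConvexResponse.dualResidual_le` with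
all four hypotheses discharged in the package: chain rule `dDeficit_eq_chain`, the gauge-fixed lift
`tangentLift_gaugeFixed`, the defect bound `defectDerivBound_abelianModel`, and gauge-fixed fine criticality as the only
assumption on `u`).  Let `T` be any set of coarse directions and `u` a fine field of the plane-`(μ, ν)`
curvature-regular set at level `K` that is CRITICAL FOR THE FINE ACTION `actF` AMONG THE GAUGE-FIXED FINE DIRECTIONS
(`R∂ᴴψ = 0`) WHOSE BLOCK AVERAGE LIES IN `T` (the Lagrange condition of a minimiser under an averaging constraint and
the gauge condition).  Then `|D actC(Qu)[φ]| ≤ √(2 n^d γ₁) · (2√(6(d+2)) n² K) · ⟨∂₁φ, ∂₁φ⟩^{1/2}` for every `φ ∈ T`: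
the coarse residual of the averaged field is `O(K)` IN THE DUAL OF THE COARSE CURVATURE ENERGY (`H^{−1}` form of
record §3 (3.6)), constants depending on `d` and the fixed block size only.  Nothing about Bałaban's non-linear
average, his minimisers or NE3 itself. [folklore] -/
theorem dualResidual_gaugeFixed (μ ν : Fin d) (K : ℝ) (hK : 0 ≤ K) (T : Set (Tor M × Fin d → ℂ))
    {u : Tor (fine n M) × Fin d → ℂ} (hu : u ∈ critSet n M μ ν K)
    (hcrit : ∀ ψ : Tor (fine n M) × Fin d → ℂ, QvOp n M *ᵥ ψ ∈ T → gaugeFix n M ψ → dActF n M μ ν u ψ = 0)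
    {φ : Tor M × Fin d → ℂ} (hφ : φ ∈ T) :
    |dActC n M μ ν (QvOp n M *ᵥ u) φ|
      ≤ Real.sqrt (2 * (n : ℝ) ^ d * gamma1 d) * (2 * Real.sqrt (6 * ((d : ℝ) + 2)) * (n : ℝ) ^ 2 * K)
          * coarseEnergyNorm M φ := by
  let crit : Set (Tor (fine n M) × Fin d → ℂ) :=
    {v | v ∈ critSet n M μ ν K ∧
      ∀ ψ : Tor (fine n M) × Fin d → ℂ, QvOp n M *ᵥ ψ ∈ T → gaugeFix n M ψ → dActF n M μ ν v ψ = 0}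
  have hsub : crit ⊆ critSet n M μ ν K := fun v hv => hv.1
  have hu' : u ∈ crit := ⟨hu, hcrit⟩
  have hdef : DefectDerivBound crit (dDeficit n M μ ν) (fineNorm n M μ ν)
      (2 * Real.sqrt (6 * ((d : ℝ) + 2)) * (n : ℝ) ^ 2 * K) :=
    defectDerivBound_mono hsub (defectDerivBound_abelianModel n M μ ν K hK)
  have hδ : 0 ≤ 2 * Real.sqrt (6 * ((d : ℝ) + 2)) * (n : ℝ) ^ 2 * K := by positivity
  exact dualResidual_le (crit := crit) (T := T) (fineT := fun _ ψ => QvOp n M *ᵥ ψ ∈ T ∧ gaugeFix n M ψ)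
    (dActC n M μ ν) (dActF n M μ ν) (fun v => QvOp n M *ᵥ v) (fun _ => dQ n M) (dDeficit n M μ ν)
    (fun v ψ => dDeficit_eq_chain n M μ ν v ψ) (fun v hv ψ hψ => hv.2 ψ hψ.1 hψ.2)
    (tangentLift_gaugeFixed n M crit T μ ν) hdef hδ hu' hφ

/-- NON-VACUITY of the hypotheses of `dualResidual_gaugeFixed`: `u = 0 ∈ critSet K` is critical in every direction
(`dActF_zero`), and gauge-fixed directions with prescribed average exist (`H_kφ`). [folklore] -/
theorem dualResidual_gaugeFixed_nonvacuous (μ ν : Fin d) (K : ℝ) (T : Set (Tor M × Fin d → ℂ)) :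
    (0 : Tor (fine n M) × Fin d → ℂ) ∈ critSet n M μ ν K ∧
      (∀ ψ : Tor (fine n M) × Fin d → ℂ, QvOp n M *ᵥ ψ ∈ T → gaugeFix n M ψ →
        dActF n M μ ν (0 : Tor (fine n M) × Fin d → ℂ) ψ = 0) ∧
      (∀ φ ∈ T, ∃ ψ : Tor (fine n M) × Fin d → ℂ, QvOp n M *ᵥ ψ = φ ∧ gaugeFix n M ψ) :=
  ⟨zero_mem_critSet n M μ ν K, fun ψ _ _ => dActF_zero n M μ ν ψ,
    fun φ _ => ⟨Hk n NeZero.one_le M 1 one_pos *ᵥ φ, QvOp_Hk_mulVec n NeZero.one_le M 1 one_pos φ,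
      gaugeFix_Hk n M 1 one_pos φ⟩⟩

end

end Literature.MathematicalPhysics.QuantumFieldTheory.Balaban1983to89.T4AveragingDeficitGaugeLift
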